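import Literature.Analysis.FluidPDE.ClassicalSolution
import Mathlib.Analysis.Calculus.BumpFunction.InnerProduct
import Mathlib.Analysis.InnerProductSpace.Calculus

/-!
# Crux `SymmetricScarExists` (stmt-NavierStokesRegularity-11718), line `logtime-bernoulli-certificate`:
# an explicit non-zero periodic member of the KINEMATIC weighted class with no good slice

Refuter's negative lemma, part 1 of 2 (drefute gen 3; `--supports stmt-NavierStokesRegularity-11718`;
theorems only, no definitions, no named facts).  The bet stubs of the line quantify over
`LB(C, K) = {(U, P) : IsBackwardLeraySolutionOn univ 1 U P ∧ eight weighted bounds}`; previous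
generations could only exhibit its ZERO member.  Dropping exactly one of the four fields of
`IsBackwardLeraySolutionOn` — the momentum equation — we construct
`U(s, y) = cos s · φ(‖y‖²) A y + sin s · φ(‖y‖²) A′ y` (`φ` a smooth bump, `A`, `A′` rotation generators
of the `(e₀,e₁)`- and `(e₁,e₂)`-planes): jointly smooth, divergence free
(`isDivFree_radial_smul_skew`: `div(φ(‖y‖²) A y) = φ tr A + 2φ′⟪y, A y⟫ = 0` for skew `A`), obeying all
eight weighted bounds with `P = 0` (compact support, `exists_weight_pow_mul_norm_le`), `2π`-periodic,
and with `∂ₛU(s, e₀) = −sin s · e₁`, `∂ₛU(s, e₂) = −cos s · e₁` — so EVERY slice has a point of `B₂`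
where `‖∂ₛU‖ > 1/2` (`exists_kinematic_member`).  Part 2 (`OneGoodSliceWithoutMomentum.lean`) turns
this into `oneGoodSlice_false_without_momentum` and `finiteGaussianAction_false_without_momentum`.
No `sorry`.
-/

noncomputable section

open Set Metric Function Filter Topology
open scoped ContDiff InnerProductSpace RealInnerProductSpace

namespace Summit.NavierStokesRegularity.NavierStokesRegularity.Theorems.SymmetricScarExists.Negative

set_option linter.dupNamespace false

open Literature.Analysis.FluidPDE

/-! ### Generic kinematics: radial × skew fields are divergence free; compact support gives weighted bounds -/

section Generic

variable {E : Type*} [NormedAddCommGroup E] [InnerProductSpace ℝ E] [FiniteDimensional ℝ E]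

omit [FiniteDimensional ℝ E] in
/-- The infinitesimal rotation `y ↦ ⟪u, y⟫ v − ⟪v, y⟫ u` of the `(u, v)`-plane is skew:
`⟪y, (⟪u, y⟫ v − ⟪v, y⟫ u)⟫ = 0`. [folklore] -/
theorem inner_rotGen_self (u v y : E) :
    ⟪y, ((innerSL ℝ u).smulRight v - (innerSL ℝ v).smulRight u) y⟫ = 0 := by
  simp only [sub_apply, ContinuousLinearMap.smulRight_apply, innerSL_apply_apply,
    inner_sub_right, real_inner_smul_right, real_inner_comm y]
  ring

/-- **Radial × skew is divergence free**: for a differentiable `φ : ℝ → ℝ` and a linear map `A` with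
`⟪y, A y⟫ = 0` for all `y`, the field `y ↦ φ(‖y‖²) A y` has `div = φ(‖y‖²) tr A + 2 φ′(‖y‖²) ⟪y, A y⟫ = 0`
(`tr A = Σ ⟪bᵢ, A bᵢ⟫ = 0` termwise). [folklore] -/
theorem isDivFree_radial_smul_skew (φ : ℝ → ℝ) (hφ : Differentiable ℝ φ) (A : E →L[ℝ] E)
    (hA : ∀ y, ⟪y, A y⟫ = 0) : VectorCalculus.IsDivFree (fun y => φ (‖y‖ ^ 2) • A y) := by
  intro x
  set b := stdOrthonormalBasis ℝ E
  -- the derivative of the radial factor and of the field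
  have h1 : HasFDerivAt (fun y : E => ‖y‖ ^ 2) (2 • innerSL ℝ x) x :=
    (hasStrictFDerivAt_norm_sq x).hasFDerivAt
  have h2 : HasFDerivAt φ ((1 : ℝ →L[ℝ] ℝ).smulRight (deriv φ (‖x‖ ^ 2))) (‖x‖ ^ 2) :=
    (hφ _).hasDerivAt.hasFDerivAt
  have hc : HasFDerivAt (fun y : E => φ (‖y‖ ^ 2))
      (((1 : ℝ →L[ℝ] ℝ).smulRight (deriv φ (‖x‖ ^ 2))).comp (2 • innerSL ℝ x)) x := h2.comp x h1
  have hV : HasFDerivAt (fun y : E => φ (‖y‖ ^ 2) • A y)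
      (φ (‖x‖ ^ 2) • A +
        (((1 : ℝ →L[ℝ] ℝ).smulRight (deriv φ (‖x‖ ^ 2))).comp (2 • innerSL ℝ x)).smulRight (A x)) x :=
    hc.smul A.hasFDerivAt
  rw [divergence_eq_sum_inner_fderiv b, hV.fderiv]
  simp only [add_apply, smul_apply,
    ContinuousLinearMap.smulRight_apply, ContinuousLinearMap.coe_comp, Function.comp_apply,
    one_apply_eq_self, innerSL_apply_apply, inner_add_right, real_inner_smul_right, hA,
    mul_zero, zero_add, smul_eq_mul, nsmul_eq_mul, Nat.cast_ofNat]
  have key : ∑ i, ⟪x, b i⟫ * ⟪b i, A x⟫ = 0 := by rw [b.sum_inner_mul_inner, hA]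
  calc ∑ i, (2 * ⟪x, b i⟫) * deriv φ (‖x‖ ^ 2) * ⟪b i, A x⟫
      = 2 * deriv φ (‖x‖ ^ 2) * ∑ i, ⟪x, b i⟫ * ⟪b i, A x⟫ := by
        rw [Finset.mul_sum]
        exact Finset.sum_congr rfl fun i _ => by ring
    _ = 0 := by rw [key, mul_zero]

omit [InnerProductSpace ℝ E] [FiniteDimensional ℝ E] in
/-- **Compact support gives every polynomially weighted bound**: a continuous compactly supported
`g` satisfies `(1 + ‖y‖)ᵏ ‖g y‖ ≤ C` for all `k ≤ 4` with one constant `C ≥ 0`. [folklore] -/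
theorem exists_weight_pow_mul_norm_le {F : Type*} [NormedAddCommGroup F] {g : E → F}
    (hg : Continuous g) (hsupp : HasCompactSupport g) :
    ∃ C : ℝ, 0 ≤ C ∧ ∀ k : ℕ, k ≤ 4 → ∀ y : E, (1 + ‖y‖) ^ k * ‖g y‖ ≤ C := by
  have hc : Continuous fun y => (1 + ‖y‖) ^ 4 * ‖g y‖ :=
    ((continuous_const.add continuous_norm).pow 4).mul hg.norm
  have hs : HasCompactSupport ((fun y : E => (1 + ‖y‖) ^ 4) * fun y => ‖g y‖) := hsupp.norm.mul_left
  obtain ⟨C, hC⟩ := hc.bounded_above_of_compact_support hs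
  refine ⟨C, (norm_nonneg _).trans (hC 0), fun k hk y => ?_⟩
  have h1 : (1 : ℝ) ≤ 1 + ‖y‖ := by linarith [norm_nonneg y]
  calc (1 + ‖y‖) ^ k * ‖g y‖ ≤ (1 + ‖y‖) ^ 4 * ‖g y‖ :=
        mul_le_mul_of_nonneg_right (pow_le_pow_right₀ h1 hk) (norm_nonneg _)
    _ ≤ ‖(1 + ‖y‖) ^ 4 * ‖g y‖‖ := Real.le_norm_self _
    _ ≤ C := hC y

/-- `‖c • a + d • b‖ ≤ ‖a‖ + ‖b‖` when `|c|, |d| ≤ 1`. [folklore] -/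
theorem norm_smul_add_smul_le {F : Type*} [NormedAddCommGroup F] [NormedSpace ℝ F] {c d : ℝ}
    (hc : |c| ≤ 1) (hd : |d| ≤ 1) (a b : F) : ‖c • a + d • b‖ ≤ ‖a‖ + ‖b‖ := by
  calc ‖c • a + d • b‖ ≤ ‖c • a‖ + ‖d • b‖ := norm_add_le _ _
    _ = |c| * ‖a‖ + |d| * ‖b‖ := by rw [norm_smul, norm_smul, Real.norm_eq_abs, Real.norm_eq_abs]
    _ ≤ 1 * ‖a‖ + 1 * ‖b‖ := by gcongr
    _ = ‖a‖ + ‖b‖ := by ring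

end Generic

/-! ### Linear combinations of divergence-free fields -/

section Linear

variable {E : Type*} [NormedAddCommGroup E] [InnerProductSpace ℝ E] [FiniteDimensional ℝ E]

omit [FiniteDimensional ℝ E] in
/-- `c • v + d • w` is divergence free for divergence-free differentiable `v`, `w` (the divergence
is the trace of the derivative, which is linear). [folklore] -/
theorem isDivFree_smul_add_smul {v w : E → E} (hv : VectorCalculus.IsDivFree v)
    (hw : VectorCalculus.IsDivFree w) (hvd : Differentiable ℝ v) (hwd : Differentiable ℝ w)
    (c d : ℝ) : VectorCalculus.IsDivFree (fun y => c • v y + d • w y) := by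
  intro x
  have h1 := hv x
  have h2 := hw x
  simp only [VectorCalculus.divergence] at h1 h2 ⊢
  have hf : HasFDerivAt (fun y => c • v y + d • w y) (c • fderiv ℝ v x + d • fderiv ℝ w x) x :=
    ((hvd x).hasFDerivAt.const_smul c).add ((hwd x).hasFDerivAt.const_smul d)
  rw [hf.fderiv, ContinuousLinearMap.toLinearMap_add, ContinuousLinearMap.toLinearMap_smul,
    ContinuousLinearMap.toLinearMap_smul, map_add, map_smul, map_smul, h1, h2, smul_zero, smul_zero,
    add_zero]

end Linear

/-! ### The explicit kinematic member of the weighted class -/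

section Witness

/-- **An explicit non-zero `2π`-periodic member of the kinematic class with no good slice.**  There is
a jointly smooth, divergence-free `U : ℝ → ℝ³ → ℝ³` obeying (with `P = 0`) all eight weighted bounds of
the class `LB(C, K)` of the line `logtime-bernoulli-certificate`, `2π`-periodic in `s`, such that EVERY
slice has a point `y ∈ B₂` with `‖∂ₛU(s, y)‖ > 1/2`.  Witness:
`U(s, y) = cos s · φ(‖y‖²) A y + sin s · φ(‖y‖²) A′ y`, `φ` a smooth bump, `A`, `A′` the rotation
generators of the `(e₀,e₁)`- and `(e₁,e₂)`-planes; `∂ₛU(s, e₀) = −sin s · e₁`, `∂ₛU(s, e₂) = −cos s · e₁`. [folklore] -/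
theorem exists_kinematic_member :
    ∃ U : ℝ → EuclideanSpace ℝ (Fin 3) → EuclideanSpace ℝ (Fin 3),
      IsSmoothSpaceTimeOn (univ : Set ℝ) U ∧ (∀ s, VectorCalculus.IsDivFree (U s)) ∧
      (∃ C K : ℝ, 0 ≤ K ∧ ∀ (s : ℝ) (y : EuclideanSpace ℝ (Fin 3)),
        (1 + ‖y‖) * ‖U s y‖ ≤ C ∧ (1 + ‖y‖) ^ 2 * ‖fderiv ℝ (U s) y‖ ≤ K ∧
        (1 + ‖y‖) ^ 3 * ‖iteratedFDeriv ℝ 2 (U s) y‖ ≤ K ∧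
        (1 + ‖y‖) * ‖timeDerivWithin (univ : Set ℝ) U s y‖ ≤ K ∧
        (1 + ‖y‖) ^ 2 * ‖fderiv ℝ (fun z => timeDerivWithin (univ : Set ℝ) U s z) y‖ ≤ K ∧
        (1 + ‖y‖) ^ 3 * ‖timeDerivWithin (univ : Set ℝ) U s y + (1 / 2 : ℝ) • U s y
            + (1 / 2 : ℝ) • fderiv ℝ (U s) y y‖ ≤ K) ∧
      (∀ s y, U (s + 2 * Real.pi) y = U s y) ∧
      (∀ s, ∃ y : EuclideanSpace ℝ (Fin 3), ‖y‖ < 2 ∧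
        (1 / 2 : ℝ) < ‖timeDerivWithin (univ : Set ℝ) U s y‖) := by
  -- ## the data
  set b : OrthonormalBasis (Fin 3) ℝ (EuclideanSpace ℝ (Fin 3)) := EuclideanSpace.basisFun (Fin 3) ℝ
    with hb
  set A : EuclideanSpace ℝ (Fin 3) →L[ℝ] EuclideanSpace ℝ (Fin 3) :=
    (innerSL ℝ (b 0)).smulRight (b 1) - (innerSL ℝ (b 1)).smulRight (b 0) with hA
  set A' : EuclideanSpace ℝ (Fin 3) →L[ℝ] EuclideanSpace ℝ (Fin 3) :=
    (innerSL ℝ (b 1)).smulRight (b 2) - (innerSL ℝ (b 2)).smulRight (b 1) with hA'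
  set φ₀ : ContDiffBump (0 : ℝ) := ⟨1, 4, one_pos, by norm_num⟩ with hφ₀
  set V : EuclideanSpace ℝ (Fin 3) → EuclideanSpace ℝ (Fin 3) := fun y => φ₀ (‖y‖ ^ 2) • A y with hV
  set W : EuclideanSpace ℝ (Fin 3) → EuclideanSpace ℝ (Fin 3) := fun y => φ₀ (‖y‖ ^ 2) • A' y with hW
  set U : ℝ → EuclideanSpace ℝ (Fin 3) → EuclideanSpace ℝ (Fin 3) :=
    fun s y => Real.cos s • V y + Real.sin s • W y with hU
  -- ## orthonormality bookkeeping
  have hbn : ∀ i, ‖b i‖ = 1 := fun i => b.orthonormal.1 i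
  have hb00 : ⟪b 0, b 0⟫ = (1 : ℝ) :=
    (b.inner_eq_ite 0 0).trans (if_pos rfl)
  have hb11 : ⟪b 1, b 1⟫ = (1 : ℝ) :=
    (b.inner_eq_ite 1 1).trans (if_pos rfl)
  have hb22 : ⟪b 2, b 2⟫ = (1 : ℝ) :=
    (b.inner_eq_ite 2 2).trans (if_pos rfl)
  have hb01 : ⟪b 0, b 1⟫ = (0 : ℝ) :=
    (b.inner_eq_ite 0 1).trans (if_neg (by decide))
  have hb10 : ⟪b 1, b 0⟫ = (0 : ℝ) :=
    (b.inner_eq_ite 1 0).trans (if_neg (by decide))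
  have hb02 : ⟪b 0, b 2⟫ = (0 : ℝ) :=
    (b.inner_eq_ite 0 2).trans (if_neg (by decide))
  have hb20 : ⟪b 2, b 0⟫ = (0 : ℝ) :=
    (b.inner_eq_ite 2 0).trans (if_neg (by decide))
  have hb12 : ⟪b 1, b 2⟫ = (0 : ℝ) :=
    (b.inner_eq_ite 1 2).trans (if_neg (by decide))
  have hb21 : ⟪b 2, b 1⟫ = (0 : ℝ) :=
    (b.inner_eq_ite 2 1).trans (if_neg (by decide))
  have hA0 : A (b 0) = b 1 := by
    simp only [hA, sub_apply, ContinuousLinearMap.smulRight_apply, innerSL_apply_apply, hb00, hb10,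
      one_smul, zero_smul ℝ, sub_zero]
  have hA2 : A (b 2) = 0 := by
    simp only [hA, sub_apply, ContinuousLinearMap.smulRight_apply, innerSL_apply_apply, hb02, hb12,
      zero_smul ℝ, sub_zero]
  have hA'0 : A' (b 0) = 0 := by
    simp only [hA', sub_apply, ContinuousLinearMap.smulRight_apply, innerSL_apply_apply, hb10, hb20,
      zero_smul ℝ, sub_zero]
  have hA'2 : A' (b 2) = -b 1 := by
    simp only [hA', sub_apply, ContinuousLinearMap.smulRight_apply, innerSL_apply_apply, hb12, hb22,
      one_smul, zero_smul ℝ, zero_sub]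
  -- ## the bump: `φ₀ 1 = 1`, `φ₀ r = 0` for `r ≥ 4`
  have hφ1 : (φ₀ : ℝ → ℝ) 1 = 1 := φ₀.one_of_mem_closedBall (by simp [hφ₀])
  have hφ4 : ∀ r : ℝ, 4 ≤ r → (φ₀ : ℝ → ℝ) r = 0 := fun r hr =>
    φ₀.zero_of_le_dist (by rw [Real.dist_eq, sub_zero, abs_of_nonneg (by linarith)]; exact hr)
  -- ## values at `e₀`, `e₂`
  have hV0 : V (b 0) = b 1 := by simp only [hV, hbn, one_pow, hφ1, one_smul, hA0]
  have hW0 : W (b 0) = 0 := by simp only [hW, hA'0, smul_zero]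
  have hV2 : V (b 2) = 0 := by simp only [hV, hA2, smul_zero]
  have hW2 : W (b 2) = -b 1 := by simp only [hW, hbn, one_pow, hφ1, one_smul, hA'2]
  -- ## smoothness of the pieces
  have hφc : ContDiff ℝ ∞ (φ₀ : ℝ → ℝ) := φ₀.contDiff
  have hφd : Differentiable ℝ (φ₀ : ℝ → ℝ) := hφc.differentiable (by simp)
  have hVc : ContDiff ℝ ∞ V := (hφc.comp (contDiff_norm_sq ℝ)).smul A.contDiff
  have hWc : ContDiff ℝ ∞ W := (hφc.comp (contDiff_norm_sq ℝ)).smul A'.contDiff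
  have hVd : Differentiable ℝ V := hVc.differentiable (by simp)
  have hWd : Differentiable ℝ W := hWc.differentiable (by simp)
  have hUc : ContDiff ℝ ∞ (uncurry U) := by
    have e : uncurry U = fun p : ℝ × EuclideanSpace ℝ (Fin 3) =>
        Real.cos p.1 • V p.2 + Real.sin p.1 • W p.2 := by
      funext p; rfl
    rw [e]
    exact ((Real.contDiff_cos.comp contDiff_fst).smul (hVc.comp contDiff_snd)).add
      ((Real.contDiff_sin.comp contDiff_fst).smul (hWc.comp contDiff_snd))
  have hUsm : IsSmoothSpaceTimeOn (univ : Set ℝ) U := hUc.contDiffOn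
  -- ## compact support of the pieces (inside the closed ball of radius 2)
  have hsuppV : HasCompactSupport V := by
    refine HasCompactSupport.intro (isCompact_closedBall (0 : EuclideanSpace ℝ (Fin 3)) 2) ?_
    intro y hy
    rw [mem_closedBall, dist_zero_right, not_le] at hy
    have h4 : (4 : ℝ) ≤ ‖y‖ ^ 2 := by nlinarith
    simp only [hV, hφ4 _ h4, zero_smul]
  have hsuppW : HasCompactSupport W := by
    refine HasCompactSupport.intro (isCompact_closedBall (0 : EuclideanSpace ℝ (Fin 3)) 2) ?_
    intro y hy
    rw [mem_closedBall, dist_zero_right, not_le] at hy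
    have h4 : (4 : ℝ) ≤ ‖y‖ ^ 2 := by nlinarith
    simp only [hW, hφ4 _ h4, zero_smul]
  -- ## the derivatives of `U`
  have hdt : ∀ s y, timeDerivWithin (univ : Set ℝ) U s y = -Real.sin s • V y + Real.cos s • W y := by
    intro s y
    simp only [timeDerivWithin_apply, derivWithin_univ]
    exact (((Real.hasDerivAt_cos s).smul_const (V y)).add
      ((Real.hasDerivAt_sin s).smul_const (W y))).deriv
  have hdtfun : ∀ s, (fun z => timeDerivWithin (univ : Set ℝ) U s z) =
      fun z => -Real.sin s • V z + Real.cos s • W z := fun s => funext (hdt s)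
  have hDU : ∀ s y, fderiv ℝ (U s) y = Real.cos s • fderiv ℝ V y + Real.sin s • fderiv ℝ W y :=
    fun s y => (((hVd y).hasFDerivAt.const_smul (Real.cos s)).add
      ((hWd y).hasFDerivAt.const_smul (Real.sin s))).fderiv
  have hDdt : ∀ s y, fderiv ℝ (fun z => timeDerivWithin (univ : Set ℝ) U s z) y =
      (-Real.sin s) • fderiv ℝ V y + Real.cos s • fderiv ℝ W y := fun s y => by
    rw [hdtfun s]
    exact (((hVd y).hasFDerivAt.const_smul (-Real.sin s)).add
      ((hWd y).hasFDerivAt.const_smul (Real.cos s))).fderiv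
  have hD2U : ∀ s y, iteratedFDeriv ℝ 2 (U s) y =
      Real.cos s • iteratedFDeriv ℝ 2 V y + Real.sin s • iteratedFDeriv ℝ 2 W y := by
    intro s y
    have hV2 : ContDiff ℝ 2 V := hVc.of_le (by norm_cast)
    have hW2 : ContDiff ℝ 2 W := hWc.of_le (by norm_cast)
    have e : U s = (fun z => Real.cos s • V z) + fun z => Real.sin s • W z := by funext z; rfl
    rw [e, iteratedFDeriv_add_apply (hV2.const_smul _).contDiffAt (hW2.const_smul _).contDiffAt,
      iteratedFDeriv_const_smul_apply' hV2.contDiffAt, iteratedFDeriv_const_smul_apply' hW2.contDiffAt]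
  -- ## weighted bounds of the pieces
  have habs : ∀ s, |Real.cos s| ≤ 1 ∧ |Real.sin s| ≤ 1 ∧ |(-Real.sin s)| ≤ 1 := fun s =>
    ⟨Real.abs_cos_le_one s, Real.abs_sin_le_one s, by rw [abs_neg]; exact Real.abs_sin_le_one s⟩
  obtain ⟨CV, hCV0, hCV⟩ := exists_weight_pow_mul_norm_le hVc.continuous hsuppV
  obtain ⟨CW, hCW0, hCW⟩ := exists_weight_pow_mul_norm_le hWc.continuous hsuppW
  obtain ⟨DV, hDV0, hDV⟩ := exists_weight_pow_mul_norm_le (hVc.continuous_fderiv (by simp))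
    (hsuppV.fderiv (𝕜 := ℝ))
  obtain ⟨DW, hDW0, hDW⟩ := exists_weight_pow_mul_norm_le (hWc.continuous_fderiv (by simp))
    (hsuppW.fderiv (𝕜 := ℝ))
  obtain ⟨EV, hEV0, hEV⟩ := exists_weight_pow_mul_norm_le
    (hVc.continuous_iteratedFDeriv (m := 2) (by norm_cast)) (hsuppV.iteratedFDeriv (𝕜 := ℝ) 2)
  obtain ⟨EW, hEW0, hEW⟩ := exists_weight_pow_mul_norm_le
    (hWc.continuous_iteratedFDeriv (m := 2) (by norm_cast)) (hsuppW.iteratedFDeriv (𝕜 := ℝ) 2)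
  -- ## assembly
  refine ⟨U, hUsm, fun s => ?_, ⟨CV + CW, 2 * (CV + CW + DV + DW) + EV + EW, by positivity,
    fun s y => ⟨?_, ?_, ?_, ?_, ?_, ?_⟩⟩, fun s y => ?_, fun s => ?_⟩
  · -- divergence free
    exact isDivFree_smul_add_smul
      (isDivFree_radial_smul_skew _ hφd A fun y => inner_rotGen_self _ _ y)
      (isDivFree_radial_smul_skew _ hφd A' fun y => inner_rotGen_self _ _ y) hVd hWd _ _
  · -- (i)
    have h := norm_smul_add_smul_le (habs s).1 (habs s).2.1 (V y) (W y)
    have w0 : 0 ≤ 1 + ‖y‖ := by positivity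
    calc (1 + ‖y‖) * ‖U s y‖ ≤ (1 + ‖y‖) * (‖V y‖ + ‖W y‖) := mul_le_mul_of_nonneg_left h w0
      _ = (1 + ‖y‖) ^ 1 * ‖V y‖ + (1 + ‖y‖) ^ 1 * ‖W y‖ := by ring
      _ ≤ CV + CW := add_le_add (hCV 1 (by norm_num) y) (hCW 1 (by norm_num) y)
  · -- (ii)
    rw [hDU]
    have h := norm_smul_add_smul_le (habs s).1 (habs s).2.1 (fderiv ℝ V y) (fderiv ℝ W y)
    have w0 : 0 ≤ (1 + ‖y‖) ^ 2 := by positivity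
    calc (1 + ‖y‖) ^ 2 * ‖Real.cos s • fderiv ℝ V y + Real.sin s • fderiv ℝ W y‖
        ≤ (1 + ‖y‖) ^ 2 * (‖fderiv ℝ V y‖ + ‖fderiv ℝ W y‖) := mul_le_mul_of_nonneg_left h w0
      _ = (1 + ‖y‖) ^ 2 * ‖fderiv ℝ V y‖ + (1 + ‖y‖) ^ 2 * ‖fderiv ℝ W y‖ := by ring
      _ ≤ DV + DW := add_le_add (hDV 2 (by norm_num) y) (hDW 2 (by norm_num) y)
      _ ≤ 2 * (CV + CW + DV + DW) + EV + EW := by linarith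
  · -- (iii)
    rw [hD2U]
    have h := norm_smul_add_smul_le (habs s).1 (habs s).2.1 (iteratedFDeriv ℝ 2 V y)
      (iteratedFDeriv ℝ 2 W y)
    have w0 : 0 ≤ (1 + ‖y‖) ^ 3 := by positivity
    calc (1 + ‖y‖) ^ 3 * ‖Real.cos s • iteratedFDeriv ℝ 2 V y + Real.sin s • iteratedFDeriv ℝ 2 W y‖
        ≤ (1 + ‖y‖) ^ 3 * (‖iteratedFDeriv ℝ 2 V y‖ + ‖iteratedFDeriv ℝ 2 W y‖) :=
          mul_le_mul_of_nonneg_left h w0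
      _ = (1 + ‖y‖) ^ 3 * ‖iteratedFDeriv ℝ 2 V y‖ + (1 + ‖y‖) ^ 3 * ‖iteratedFDeriv ℝ 2 W y‖ := by
          ring
      _ ≤ EV + EW := add_le_add (hEV 3 (by norm_num) y) (hEW 3 (by norm_num) y)
      _ ≤ 2 * (CV + CW + DV + DW) + EV + EW := by linarith
  · -- (vi)
    rw [hdt]
    have h := norm_smul_add_smul_le (habs s).2.2 (habs s).1 (V y) (W y)
    have w0 : 0 ≤ 1 + ‖y‖ := by positivity
    calc (1 + ‖y‖) * ‖-Real.sin s • V y + Real.cos s • W y‖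
        ≤ (1 + ‖y‖) * (‖V y‖ + ‖W y‖) := mul_le_mul_of_nonneg_left h w0
      _ = (1 + ‖y‖) ^ 1 * ‖V y‖ + (1 + ‖y‖) ^ 1 * ‖W y‖ := by ring
      _ ≤ CV + CW := add_le_add (hCV 1 (by norm_num) y) (hCW 1 (by norm_num) y)
      _ ≤ 2 * (CV + CW + DV + DW) + EV + EW := by linarith
  · -- (vii)
    rw [hDdt]
    have h := norm_smul_add_smul_le (habs s).2.2 (habs s).1 (fderiv ℝ V y) (fderiv ℝ W y)
    have w0 : 0 ≤ (1 + ‖y‖) ^ 2 := by positivity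
    calc (1 + ‖y‖) ^ 2 * ‖-Real.sin s • fderiv ℝ V y + Real.cos s • fderiv ℝ W y‖
        ≤ (1 + ‖y‖) ^ 2 * (‖fderiv ℝ V y‖ + ‖fderiv ℝ W y‖) := mul_le_mul_of_nonneg_left h w0
      _ = (1 + ‖y‖) ^ 2 * ‖fderiv ℝ V y‖ + (1 + ‖y‖) ^ 2 * ‖fderiv ℝ W y‖ := by ring
      _ ≤ DV + DW := add_le_add (hDV 2 (by norm_num) y) (hDW 2 (by norm_num) y)
      _ ≤ 2 * (CV + CW + DV + DW) + EV + EW := by linarith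
  · -- (viii)
    rw [hdt, hDU]
    have h1 := norm_smul_add_smul_le (habs s).2.2 (habs s).1 (V y) (W y)
    have h2 := norm_smul_add_smul_le (habs s).1 (habs s).2.1 (V y) (W y)
    have h3 := norm_smul_add_smul_le (habs s).1 (habs s).2.1 (fderiv ℝ V y) (fderiv ℝ W y)
    have w0 : 0 ≤ 1 + ‖y‖ := by positivity
    have hy1 : ‖y‖ ≤ 1 + ‖y‖ := by linarith
    have hn : ‖-Real.sin s • V y + Real.cos s • W y + (1 / 2 : ℝ) • (Real.cos s • V y + Real.sin s • W y)
          + (1 / 2 : ℝ) • (Real.cos s • fderiv ℝ V y + Real.sin s • fderiv ℝ W y) y‖ ≤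
        (‖V y‖ + ‖W y‖) + (1 / 2 : ℝ) * (‖V y‖ + ‖W y‖)
          + (1 / 2 : ℝ) * ((‖fderiv ℝ V y‖ + ‖fderiv ℝ W y‖) * ‖y‖) := by
      refine (norm_add₃_le).trans (add_le_add_three h1 ?_ ?_)
      · rw [norm_smul, Real.norm_eq_abs, abs_of_pos (by norm_num : (0 : ℝ) < 1 / 2)]
        exact mul_le_mul_of_nonneg_left h2 (by norm_num)
      · rw [norm_smul, Real.norm_eq_abs, abs_of_pos (by norm_num : (0 : ℝ) < 1 / 2)]
        refine mul_le_mul_of_nonneg_left ?_ (by norm_num)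
        exact (ContinuousLinearMap.le_opNorm _ _).trans (mul_le_mul_of_nonneg_right h3 (norm_nonneg _))
    have e1 := hCV 3 (by norm_num) y
    have e2 := hCW 3 (by norm_num) y
    have e3 := hDV 4 le_rfl y
    have e4 := hDW 4 le_rfl y
    have w3 : 0 ≤ (1 + ‖y‖) ^ 3 := by positivity
    calc (1 + ‖y‖) ^ 3 * ‖-Real.sin s • V y + Real.cos s • W y
            + (1 / 2 : ℝ) • (Real.cos s • V y + Real.sin s • W y)
            + (1 / 2 : ℝ) • (Real.cos s • fderiv ℝ V y + Real.sin s • fderiv ℝ W y) y‖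
        ≤ (1 + ‖y‖) ^ 3 * ((‖V y‖ + ‖W y‖) + (1 / 2 : ℝ) * (‖V y‖ + ‖W y‖)
            + (1 / 2 : ℝ) * ((‖fderiv ℝ V y‖ + ‖fderiv ℝ W y‖) * ‖y‖)) :=
          mul_le_mul_of_nonneg_left hn w3
      _ ≤ (1 + ‖y‖) ^ 3 * ((‖V y‖ + ‖W y‖) + (1 / 2 : ℝ) * (‖V y‖ + ‖W y‖)
            + (1 / 2 : ℝ) * ((‖fderiv ℝ V y‖ + ‖fderiv ℝ W y‖) * (1 + ‖y‖))) := by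
          gcongr
      _ = (3 / 2 : ℝ) * ((1 + ‖y‖) ^ 3 * ‖V y‖ + (1 + ‖y‖) ^ 3 * ‖W y‖)
            + (1 / 2 : ℝ) * ((1 + ‖y‖) ^ 4 * ‖fderiv ℝ V y‖ + (1 + ‖y‖) ^ 4 * ‖fderiv ℝ W y‖) := by
          ring
      _ ≤ (3 / 2 : ℝ) * (CV + CW) + (1 / 2 : ℝ) * (DV + DW) := by gcongr
      _ ≤ 2 * (CV + CW + DV + DW) + EV + EW := by linarith
  · -- periodicity
    simp only [hU, Real.cos_add_two_pi, Real.sin_add_two_pi]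
  · -- no good slice: `e₀` or `e₂`
    by_cases hs : (1 / 2 : ℝ) < |Real.sin s|
    · refine ⟨b 0, by rw [hbn]; norm_num, ?_⟩
      rw [hdt, hV0, hW0, smul_zero, add_zero, norm_smul, Real.norm_eq_abs, abs_neg, hbn, mul_one]
      exact hs
    · refine ⟨b 2, by rw [hbn]; norm_num, ?_⟩
      rw [hdt, hV2, hW2, smul_zero, zero_add, smul_neg, norm_neg, norm_smul, Real.norm_eq_abs, hbn,
        mul_one]
      rw [not_lt] at hs
      by_contra hc
      rw [not_lt] at hc
      have h1 : Real.sin s ^ 2 ≤ (1 / 2 : ℝ) ^ 2 := by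
        rw [← sq_abs]; exact pow_le_pow_left₀ (abs_nonneg _) hs 2
      have h2 : Real.cos s ^ 2 ≤ (1 / 2 : ℝ) ^ 2 := by
        rw [← sq_abs]; exact pow_le_pow_left₀ (abs_nonneg _) hc 2
      have h3 := Real.sin_sq_add_cos_sq s
      norm_num at h1 h2
      linarith

end Witness

end Summit.NavierStokesRegularity.NavierStokesRegularity.Theorems.SymmetricScarExists.Negative

end
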